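import Summits.Ventures.PercRepro.S1PerFlatCount
import Summits.Ventures.PercRepro.CoreFourCounts
import Summits.Ventures.PercRepro.MatroidMidCount

/-!
# PercRepro — S1 Y-SIDE: the lower bound for `#Y(p, 4)` and the exact `Φ(p, 4)` (p4, gen 14; SUBCLAIM-S1 §5)

`proofs/SUBCLAIM-S1-p2.md` §5 (Y1)–(Y3) and (Φ), typed per `proofs/S1-LEAN-SPEC-p2.md` L3. Write `n = |E|`, `s_k`
the number of `k`-circuits, `Π_all`, `Π_{S₀}`, `RS`, `RB` as in `S1PerFlatCount`.

* **`phiK_four_mul_choose_eq`** (Φ) — `Φ(p, 4)·C(p + 4, 4) = 2^{p+4} − 2·Σ_{u ≤ 4} C(p + 4, u)` for `p ≥ 5`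
  (the two ends of the binomial row are mirror images; the `q = 3` analogue is `phiK_three_mul_choose_eq`);
* **`ncard_rankLe3_ge_five_le`** (Y3) — the sets `A ⊆ E` with `r(A) ≤ 3` and `|A| ≥ 5` number at most
  `22·(s₃·(n − 3) + s₄)`: each lies in a plane with `≤ 6` points, a plane with `≥ 5` points contains a rank-`3`
  four-set which lies in no other plane, and a plane carries `≤ 7 ≤ 22` subsets with `≥ 5` points;
* **`ncard_rankEq4_ge_five_le`** (Y2) — `7560·#{A : r(A) = 4, |A| ≥ 5} ≤ RS 10·Π_all + RB 10·Π_{S₀}`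
  (`ncard_rank4_Icc_le` with the cap `10 = f(4)`);
* **`midCount_ge`** (Y1) — `7560·Σ_{j=5}^{p−1} C(n, j) ≤ 7560·#Y(p, 4) + 7560·22·(s₃(n − 3) + s₄) +
  (RS 10·Π_all + RB 10·Π_{S₀})` (no rank hypothesis needed): a set with `5 ≤ |A| ≤ p − 1` has rank `< p` and
  lies in `Y` unless its rank is `≤ 4`.
Axioms: standard.
-/

open scoped Matroid

namespace PercRepro

namespace S1

open Set

variable {α : Type}

/-- `Σ_{4<u<p} C(p+4,u) + 2·Σ_{u<5} C(p+4,u) = 2^{p+4}` for `p ≥ 5` (mirror symmetry of the binomial row). -/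
theorem sum_Ioo_choose_add_four (p : ℕ) (hp : 5 ≤ p) :
    (∑ u ∈ Finset.Ioo 4 p, Nat.choose (p + 4) u) + 2 * ∑ u ∈ Finset.range 5, Nat.choose (p + 4) u = 2 ^ (p + 4) := by
  have hIoo : Finset.Ioo 4 p = Finset.Ico 5 p := by
    ext u; simp only [Finset.mem_Ioo, Finset.mem_Ico]; omega
  have h1 := Finset.sum_range_add_sum_Ico (fun u => Nat.choose (p + 4) u) (show 5 ≤ p + 4 + 1 by omega)
  rw [Nat.sum_range_choose] at h1
  have h2 := Finset.sum_Ico_consecutive (fun u => Nat.choose (p + 4) u) (show 5 ≤ p by omega)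
    (show p ≤ p + 4 + 1 by omega)
  -- the top end reflects onto the bottom end
  have h3 : ∑ u ∈ Finset.Ico p (p + 4 + 1), Nat.choose (p + 4) u = ∑ u ∈ Finset.range 5, Nat.choose (p + 4) u := by
    have h3a : ∑ u ∈ Finset.Ico p (p + 4 + 1), Nat.choose (p + 4) u
        = ∑ u ∈ Finset.Ico p (p + 4 + 1), Nat.choose (p + 4) (p + 4 - u) := by
      apply Finset.sum_congr rfl
      intro u hu
      simp only [Finset.mem_Ico] at hu
      exact (Nat.choose_symm (by omega)).symm
    rw [h3a, Finset.sum_Ico_reflect (fun j => Nat.choose (p + 4) j) p (le_refl (p + 4 + 1))]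
    have e1 : p + 4 + 1 - (p + 4 + 1) = 0 := by omega
    have e2 : p + 4 + 1 - p = 5 := by omega
    rw [e1, e2, Finset.range_eq_Ico]
  rw [hIoo]
  omega

/-- **(Φ)** `Φ(p, 4)·C(p + 4, 4) = 2^{p+4} − 2·Σ_{u<5} C(p + 4, u)` in `ℚ`, for `p ≥ 5`. -/
theorem phiK_four_mul_choose_eq (p : ℕ) (hp : 5 ≤ p) :
    phiK p 4 * ((p + 4).choose 4 : ℚ) = 2 ^ (p + 4) - 2 * ∑ u ∈ Finset.range 5, ((p + 4).choose u : ℚ) := by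
  have hsymm : Nat.choose (p + 4) p = Nat.choose (p + 4) 4 := Nat.choose_symm_add
  have hpos : (0 : ℚ) < (Nat.choose (p + 4) 4 : ℚ) := by
    exact_mod_cast Nat.choose_pos (by omega)
  have hmul : phiK p 4 * ((p + 4).choose 4 : ℚ) = ∑ u ∈ Finset.Ioo 4 p, (Nat.choose (p + 4) u : ℚ) := by
    unfold phiK
    rw [hsymm, div_mul_cancel₀ _ hpos.ne']
  rw [hmul]
  have h := sum_Ioo_choose_add_four p hp
  have h' : ((∑ u ∈ Finset.Ioo 4 p, Nat.choose (p + 4) u : ℕ) : ℚ) +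
      2 * ((∑ u ∈ Finset.range 5, Nat.choose (p + 4) u : ℕ) : ℚ) = (2 : ℚ) ^ (p + 4) := by exact_mod_cast h
  push_cast at h'
  linarith

/-- Without circuits of `≤ 2` elements, two distinct points have rank `2`. -/
theorem eRk_pair_eq_two_of_hcirc (M : Matroid α) [M.Finite] (hcirc : ∀ C, M.IsCircuit C → 3 ≤ C.encard)
    {e f : α} (he : e ∈ M.E) (hf : f ∈ M.E) (hef : e ≠ f) : M.eRk {e, f} = 2 := by
  have hind : M.Indep {e, f} := by
    by_contra hdep
    have hdep' : M.Dep {e, f} := ⟨hdep, pair_subset he hf⟩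
    obtain ⟨C, hCsub, hC⟩ := hdep'.exists_isCircuit_subset
    have h3 := hcirc C hC
    have hle : C.encard ≤ ({e, f} : Set α).encard := encard_le_encard hCsub
    rw [encard_pair hef] at hle
    exact absurd (h3.trans hle) (by norm_num)
  rw [hind.eRk_eq_encard, encard_pair hef]

/-- `β_6(m) ≤ 7` for `m ≤ 6`: a plane with `≤ 6` points carries at most `7` subsets with `5 ≤ |A| ≤ 6`. -/
theorem beta_six_le (m : ℕ) (hm : m ≤ 6) : beta m 6 ≤ 7 := by
  unfold beta
  interval_cases m <;> decide

/-- **(Y3)** The sets `A ⊆ E` of rank `≤ 3` with `≥ 5` points number at most `22·(s₃·(n − 3) + s₄)`. -/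
theorem ncard_rankLe3_ge_five_le (M : Matroid α) [M.Finite]
    (hcirc : ∀ C, M.IsCircuit C → 3 ≤ C.encard)
    (hline : ∀ L ⊆ M.E, M.eRk L ≤ 2 → L.ncard ≤ 3) (hplane : ∀ P ⊆ M.E, M.eRk P ≤ 3 → P.ncard ≤ 6) :
    {A : Set α | A ⊆ M.E ∧ M.eRk A ≤ 3 ∧ 5 ≤ A.ncard}.ncard ≤
      22 * ({C : Set α | M.IsCircuit C ∧ C.ncard = 3}.ncard * (M.E.ncard - 3) +
        {C : Set α | M.IsCircuit C ∧ C.ncard = 4}.ncard) := by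
  classical
  set T := {A : Set α | A ⊆ M.E ∧ M.eRk A ≤ 3 ∧ 5 ≤ A.ncard} with hT
  have hTfin : T.Finite := M.ground_finite.finite_subsets.subset (fun A hA => hA.1)
  -- rank `≥ 2`, else `T` is empty
  by_cases hrank : 2 ≤ M.eRank
  swap
  · have hempty : T = ∅ := by
      rw [Set.eq_empty_iff_forall_notMem]
      rintro A ⟨hAE, -, h5⟩
      have hle : M.eRk A ≤ 2 := (M.eRk_le_eRank A).trans (le_of_not_ge hrank)
      have := hline A hAE hle
      omega
    rw [hempty, ncard_empty]
    exact Nat.zero_le _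
  have hs : ∀ e ∈ M.E, ∀ f ∈ M.E, e ≠ f → M.eRk {e, f} = 2 := fun e he f hf hef =>
    eRk_pair_eq_two_of_hcirc M hcirc he hf hef
  have hD4 := CoreFour.ncard_four_sets_le (M := M) hs hrank
  -- the planes: the closures of the members of `T`
  set Tf := hTfin.toFinset with hTf
  have hmemT : ∀ A, A ∈ Tf ↔ A ⊆ M.E ∧ M.eRk A ≤ 3 ∧ 5 ≤ A.ncard := by
    intro A; rw [hTf, Set.Finite.mem_toFinset]; rfl
  set PL := Tf.image M.closure with hPL
  have hplaneP : ∀ P ∈ PL, P ⊆ M.E ∧ M.eRk P = 3 ∧ M.closure P = P ∧ 5 ≤ P.ncard ∧ P.ncard ≤ 6 := by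
    intro P hP
    rw [hPL, Finset.mem_image] at hP
    obtain ⟨A, hA, rfl⟩ := hP
    obtain ⟨hAE, hrA, h5⟩ := (hmemT A).1 hA
    have h3 : (3 : ℕ∞) ≤ M.eRk A := three_le_eRk_of_four_le_ncard M hline hAE (by omega)
    have hrA' : M.eRk A = 3 := le_antisymm hrA h3
    have hclE : M.closure A ⊆ M.E := M.closure_subset_ground A
    have hrcl : M.eRk (M.closure A) = 3 := by rw [M.eRk_closure_eq]; exact hrA'
    refine ⟨hclE, hrcl, M.closure_closure A, ?_, hplane _ hclE hrcl.le⟩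
    exact h5.trans (Set.ncard_le_ncard (M.subset_closure A hAE) (M.ground_finite.subset hclE))
  -- per plane at most `7` members
  have hfib : ∀ P ∈ PL, (Tf.filter (fun A => M.closure A = P)).card ≤ 7 := by
    intro P hP
    obtain ⟨hPE, -, -, -, h6⟩ := hplaneP P hP
    have hPfin : P.Finite := M.ground_finite.subset hPE
    rw [← Set.ncard_coe_finset]
    refine ((Set.ncard_le_ncard ?_ (hPfin.finite_subsets.subset (fun B hB => hB.1))).trans
      (ncard_subsets_Icc_le hPfin 6)).trans (beta_six_le _ h6)
    intro A hA
    rw [Finset.mem_coe, Finset.mem_filter, hmemT] at hA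
    obtain ⟨⟨hAE, -, h5⟩, hclA⟩ := hA
    have hAP : A ⊆ P := by rw [← hclA]; exact M.subset_closure A hAE
    exact ⟨hAP, h5, (Set.ncard_le_ncard hAP hPfin).trans h6⟩
  have hTcount : Tf.card ≤ 7 * PL.card := by
    rw [Finset.card_eq_sum_card_fiberwise (f := M.closure) (t := PL)
      (fun A hA => Finset.mem_image_of_mem _ hA)]
    calc ∑ P ∈ PL, (Tf.filter (fun A => M.closure A = P)).card ≤ ∑ _P ∈ PL, 7 := Finset.sum_le_sum hfib
      _ = 7 * PL.card := by rw [Finset.sum_const, smul_eq_mul, mul_comm]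
  -- the planes inject into the rank-`≤ 3` four-sets: choose a four-subset of each plane
  have hex : ∀ P ∈ PL, ∃ Q, Q ⊆ P ∧ Q.ncard = 4 := fun P hP =>
    Set.exists_subset_card_eq (by have := (hplaneP P hP).2.2.2.1; omega)
  choose! q hq using hex
  have hPLcount : PL.card ≤ {X : Set α | X ⊆ M.E ∧ X.ncard = 4 ∧ M.eRk X ≤ 3}.ncard := by
    rw [← Set.ncard_coe_finset]
    refine Set.ncard_le_ncard_of_injOn q ?_ ?_
      (M.ground_finite.finite_subsets.subset (fun X hX => hX.1))
    · intro P hP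
      rw [Finset.mem_coe] at hP
      obtain ⟨hPE, hrP, -, -, -⟩ := hplaneP P hP
      obtain ⟨hqP, hq4⟩ := hq P hP
      exact ⟨hqP.trans hPE, hq4, (M.eRk_mono hqP).trans hrP.le⟩
    · intro P hP P' hP' hqq
      rw [Finset.mem_coe] at hP hP'
      obtain ⟨hPE, hrP, hclP, -, -⟩ := hplaneP P hP
      obtain ⟨hP'E, hrP', hclP', -, -⟩ := hplaneP P' hP'
      have h1 := (closure_eq_of_four_subset M hline hPE hrP.le (hq P hP).1 (hq P hP).2).2
      have h2 := (closure_eq_of_four_subset M hline hP'E hrP'.le (hq P' hP').1 (hq P' hP').2).2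
      rw [← hclP, ← h1, hqq, h2, hclP']
  have hD4' : {X : Set α | X ⊆ M.E ∧ X.ncard = 4 ∧ M.eRk X ≤ 3}.ncard ≤
      {C : Set α | M.IsCircuit C ∧ C.ncard = 3}.ncard * (M.E.ncard - 3) +
        {C : Set α | M.IsCircuit C ∧ C.ncard = 4}.ncard := hD4
  have hTncard : T.ncard = Tf.card := Set.ncard_eq_toFinset_card _ hTfin
  rw [hTncard]
  omega

/-- **(Y2)** `7560·#{A ⊆ E : r(A) = 4, |A| ≥ 5} ≤ RS 10·Π_all + RB 10·Π_{S₀}` (rank-`4` sets have `≤ 10` points). -/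
theorem ncard_rankEq4_ge_five_le (M : Matroid α) [M.Finite]
    (hcirc : ∀ C, M.IsCircuit C → 3 ≤ C.encard)
    (hline : ∀ L ⊆ M.E, M.eRk L ≤ 2 → L.ncard ≤ 3) (hplane : ∀ P ⊆ M.E, M.eRk P ≤ 3 → P.ncard ≤ 6)
    (hten : ∀ X ⊆ M.E, M.eRk X ≤ 4 → X.ncard ≤ 10) {d : ℕ} (hd : M.E.encard = M.eRank + d) :
    7560 * {A : Set α | A ⊆ M.E ∧ M.eRk A = 4 ∧ 5 ≤ A.ncard}.ncard ≤
      RS 10 * ({C : Set α | M.IsCircuit C ∧ C.ncard = 3}.ncard * M.E.ncard.choose 2 +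
        {C : Set α | M.IsCircuit C ∧ C.ncard = 4}.ncard * M.E.ncard +
        {C : Set α | M.IsCircuit C ∧ C.ncard = 5}.ncard) +
      RB 10 * ({C : Set α | M.IsCircuit C ∧ C.ncard = 3}.ncard * (5 * d).choose 2 +
        {C : Set α | M.IsCircuit C ∧ C.ncard = 4}.ncard * (5 * d) +
        {C : Set α | M.IsCircuit C ∧ C.ncard = 5}.ncard) := by
  have hcore := ncard_rank4_Icc_le M hcirc hline hplane hten hd 10
  have heq : {A : Set α | A ⊆ M.E ∧ M.eRk A = 4 ∧ 5 ≤ A.ncard} =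
      {B : Set α | B ⊆ M.E ∧ M.eRk B = 4 ∧ 5 ≤ B.ncard ∧ B.ncard ≤ 10} := by
    ext A
    simp only [Set.mem_setOf_eq]
    constructor
    · rintro ⟨hAE, hr, h5⟩
      exact ⟨hAE, hr, h5, hten A hAE hr.le⟩
    · rintro ⟨hAE, hr, h5, -⟩
      exact ⟨hAE, hr, h5⟩
  rw [heq]
  exact hcore

/-- **(Y1) THE `Y`-SIDE**: for every `p`, `7560·Σ_{j=5}^{p−1} C(n, j) ≤ 7560·#Y(p, 4) + 7560·22·(s₃(n − 3) + s₄)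
+ (RS 10·Π_all + RB 10·Π_{S₀})` — a set with `5 ≤ |A| ≤ p − 1` has rank `< p` and lies in `Y(p, 4)` unless its rank
is `≤ 4`, and the rank-`≤ 3` / rank-`4` families are bounded by (Y3) / (Y2). -/
theorem midCount_ge (M : Matroid α) [M.Finite]
    (hcirc : ∀ C, M.IsCircuit C → 3 ≤ C.encard)
    (hline : ∀ L ⊆ M.E, M.eRk L ≤ 2 → L.ncard ≤ 3) (hplane : ∀ P ⊆ M.E, M.eRk P ≤ 3 → P.ncard ≤ 6)
    (hten : ∀ X ⊆ M.E, M.eRk X ≤ 4 → X.ncard ≤ 10) {d : ℕ} (hd : M.E.encard = M.eRank + d) (p : ℕ) :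
    7560 * ∑ j ∈ Finset.Ico 5 p, M.E.ncard.choose j ≤
      7560 * Matroid.midCount M p 4 +
      7560 * 22 * ({C : Set α | M.IsCircuit C ∧ C.ncard = 3}.ncard * (M.E.ncard - 3) +
        {C : Set α | M.IsCircuit C ∧ C.ncard = 4}.ncard) +
      (RS 10 * ({C : Set α | M.IsCircuit C ∧ C.ncard = 3}.ncard * M.E.ncard.choose 2 +
        {C : Set α | M.IsCircuit C ∧ C.ncard = 4}.ncard * M.E.ncard +
        {C : Set α | M.IsCircuit C ∧ C.ncard = 5}.ncard) +
      RB 10 * ({C : Set α | M.IsCircuit C ∧ C.ncard = 3}.ncard * (5 * d).choose 2 +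
        {C : Set α | M.IsCircuit C ∧ C.ncard = 4}.ncard * (5 * d) +
        {C : Set α | M.IsCircuit C ∧ C.ncard = 5}.ncard)) := by
  classical
  have hY3 := ncard_rankLe3_ge_five_le M hcirc hline hplane
  have hY2 := ncard_rankEq4_ge_five_le M hcirc hline hplane hten hd
  set Ef := M.ground_finite.toFinset with hEf
  have hEcard : Ef.card = M.E.ncard := (Set.ncard_eq_toFinset_card _ M.ground_finite).symm
  -- the sets with `5 ≤ |A| ≤ p − 1`: exactly `Σ_{j ∈ Ico 5 p} C(n, j)` of them
  set 𝓑 : ℕ → Finset (Set α) := fun j => (Ef.powersetCard j).image (fun s : Finset α => (s : Set α)) with h𝓑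
  have h𝓑card : ∀ j, (𝓑 j).card = M.E.ncard.choose j := fun j => by
    rw [h𝓑]; exact card_image_powersetCard M.ground_finite j
  have hmem𝓑 : ∀ j A, A ∈ 𝓑 j ↔ A ⊆ M.E ∧ A.ncard = j := fun j A =>
    mem_image_powersetCard_iff M.ground_finite j A
  have hdisj : ((Finset.Ico 5 p : Finset ℕ) : Set ℕ).PairwiseDisjoint 𝓑 := by
    intro i _ j _ hij
    rw [Function.onFun, Finset.disjoint_left]
    intro A hA hA'
    rw [hmem𝓑] at hA hA'
    exact hij (hA.2.symm.trans hA'.2)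
  set W := (Finset.Ico 5 p).biUnion 𝓑 with hW
  have hWcard : W.card = ∑ j ∈ Finset.Ico 5 p, M.E.ncard.choose j := by
    rw [hW, Finset.card_biUnion hdisj]
    exact Finset.sum_congr rfl (fun j _ => h𝓑card j)
  -- `W ⊆ Y ∪ T₃ ∪ T₄`
  set Y := {A : Set α | A ⊆ M.E ∧ (4 : ℕ∞) < M.eRk A ∧ M.eRk A < (p : ℕ∞)} with hY
  set T₃ := {A : Set α | A ⊆ M.E ∧ M.eRk A ≤ 3 ∧ 5 ≤ A.ncard} with hT₃
  set T₄ := {A : Set α | A ⊆ M.E ∧ M.eRk A = 4 ∧ 5 ≤ A.ncard} with hT₄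
  have hsub : (W : Set (Set α)) ⊆ Y ∪ T₃ ∪ T₄ := by
    intro A hA
    rw [Finset.mem_coe, hW, Finset.mem_biUnion] at hA
    obtain ⟨j, hj, hAj⟩ := hA
    rw [Finset.mem_Ico] at hj
    rw [hmem𝓑] at hAj
    obtain ⟨hAE, hAcard⟩ := hAj
    have hAfin : A.Finite := M.ground_finite.subset hAE
    have hlt : M.eRk A < (p : ℕ∞) := by
      calc M.eRk A ≤ A.encard := M.eRk_le_encard A
        _ = (A.ncard : ℕ∞) := hAfin.cast_ncard_eq.symm
        _ < (p : ℕ∞) := by rw [hAcard]; exact_mod_cast hj.2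
    by_cases h4 : (4 : ℕ∞) < M.eRk A
    · exact Or.inl (Or.inl ⟨hAE, h4, hlt⟩)
    · push Not at h4
      rcases h4.lt_or_eq with h | h
      · have h3 : M.eRk A ≤ 3 := by
          have : M.eRk A < (3 : ℕ∞) + 1 := by rw [show ((3 : ℕ∞) + 1) = 4 by norm_num]; exact h
          simpa using Order.le_of_lt_add_one this
        exact Or.inl (Or.inr ⟨hAE, h3, by omega⟩)
      · exact Or.inr ⟨hAE, h, by omega⟩
  have hYfin : Y.Finite := M.ground_finite.finite_subsets.subset (fun A hA => hA.1)
  have hT₃fin : T₃.Finite := M.ground_finite.finite_subsets.subset (fun A hA => hA.1)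
  have hT₄fin : T₄.Finite := M.ground_finite.finite_subsets.subset (fun A hA => hA.1)
  have hWle : W.card ≤ Y.ncard + T₃.ncard + T₄.ncard := by
    calc W.card = (W : Set (Set α)).ncard := (Set.ncard_coe_finset _).symm
      _ ≤ (Y ∪ T₃ ∪ T₄).ncard := Set.ncard_le_ncard hsub ((hYfin.union hT₃fin).union hT₄fin)
      _ ≤ (Y ∪ T₃).ncard + T₄.ncard := Set.ncard_union_le _ _
      _ ≤ Y.ncard + T₃.ncard + T₄.ncard := by
          have := Set.ncard_union_le Y T₃
          omega
  have hmid : Matroid.midCount M p 4 = Y.ncard := rfl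
  rw [← hWcard, hmid]
  have hY3' : T₃.ncard ≤ 22 * ({C : Set α | M.IsCircuit C ∧ C.ncard = 3}.ncard * (M.E.ncard - 3) +
      {C : Set α | M.IsCircuit C ∧ C.ncard = 4}.ncard) := hY3
  have hY2' : 7560 * T₄.ncard ≤ _ := hY2
  nlinarith [hWle, hY3', hY2']

end S1

end PercRepro
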